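import Literature.AlgebraicGeometry.HodgeTheory.AlgebraicMonodromyMumfordTate
import Literature.AlgebraicGeometry.HodgeTheory.MonodromySemisimpleSubvariations
import Literature.AlgebraicGeometry.HodgeTheory.RationalLattice
import HarnessLib

/-!
# The monodromy representation of a smooth projective family is semisimple
# (Deligne, *Théorie de Hodge II*, Thm. 4.2.6 with its footnote, Cor. 4.2.9 (a) — named fact)

Family `hodge`, layer `Literature/AlgebraicGeometry/HodgeTheory`. ONE named fact (D-0014), requested
(«GO», 2026-08-29) by the planner of route `HodgeConjecture/Q8SymplecticPowers` for the line
«mechanism-v2» of crux K1Q (stmt-HodgeConjecture-24190), where it is load-bearing twice: in the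
Lean-directed substitute for stub S4 («a finite-index subgroup `Γ'` of the monodromy group acts
semisimply and `End_{Γ'} = ℂ` ⇒ irreducible») and in stub S7's complete reducibility
`H² = N ⊕ N^⊥` over a finite-index `Γ″`. Companion of `AlgebraicMonodromyMumfordTate.lean`, whose carriers
(`ratMonodromyGroup`, rational transports) and statement shape (smooth projective family over a smooth
quasi-projective base, pointwise at a base point `s`) are reused verbatim; that file lists Deligne's
§4.2 among its references but vendors only the Mumford–Tate inclusion/normality package (CMSP 15.3.7,
André 1992), not semisimplicity.

## Source, verbatim (held: Numdam PDF `paper:url-844aebd4b2c4`, printed page = PDF page + 3)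

P. Deligne, *Théorie de Hodge II*, Publ. Math. IHÉS 40 (1971) 5–57 [DeligneHodgeII1971]:

* **Théorème (4.2.6)** (p. 45): «Soit `S` un espace topologique connexe, localement connexe et
  localement simplement connexe, muni d'un point base `s`. Soit `𝒞` une catégorie de familles continues
  de structures de Hodge sur `S` qui vérifie les conditions (4.2.2). Alors, si `H ∈ Ob 𝒞`, la
  représentation de `π₁(S, s)` sur la fibre `(H_ℚ)_s` est semi-simple.» Footnote (added in proof,
  p. 45): «Soit `S` un schéma lisse et connexe. Une famille de structures de Hodge sur `S` est une
  famille continue `H` de structures de Hodge sur `S` qui vérifie les conditions suivantes : a) La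
  filtration de Hodge de `(H_ℂ)_s` varie de façon holomorphe avec `s` […] b) La dérivée covariante `∇`
  vérifie `∇F^p ⊂ Ω¹_S(F^{p−1})`. Soit `𝒞` la catégorie de celles des familles continues de
  ℚ-structures de Hodge sur `S` qui sont sous-jacentes à une famille de structures de Hodge, et dont
  les facteurs directs homogènes sont polarisables. Il est clair que `𝒞` vérifie (4.2.2.1) à (4.2.2.3).
  On peut déduire de résultats de W. Schmid […] et de P. A. Griffiths [5] que `𝒞` vérifie (4.2.2.4).
  Ce théorème, dont (4.1.2) est un corollaire, permet d'appliquer (4.2.6) et ses corollaires aux objets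
  de `𝒞`.»
* **Corollaire (4.2.9)** (p. 48): «Soit `S` un schéma lisse, connexe et séparé, muni d'un point base
  `s ∈ S`. Soient `f : X → S` un morphisme de schémas tel que `Rⁿf_*ℚ` soit un système local sur `S`,
  `G` l'adhérence de Zariski de l'image de `π₁(S, s)` dans `Aut_ℂ((Rⁿf_*ℂ)_s)` et `G⁰` la composante
  neutre de `G`. Alors : a) Si `f` est propre et lisse, `G⁰` est semi-simple.» — whose proof begins
  «Quitte à remplacer `S` par un revêtement étale fini, on se ramène au cas où `G = G⁰`. Par ((4.2.5),
  (iii)), le système local `Rⁿf_*ℚ` est sous-jacent à une famille algébrique `H` de structures de Hodge,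
  donc est justiciable de (4.2.8) […] (4.2.6)».

So for `f : X → S` smooth and projective over a smooth connected quasi-projective complex `S`, the
local system `Rᵏf_*ℚ` underlies a polarizable variation of Hodge structure (the relative hyperplane
class polarizes; (4.2.5) (iii)) and `S(ℂ)` is connected, locally connected and locally simply
connected, hence by (4.2.6) the monodromy representation `π₁(S(ℂ), s) → GL(Hᵏ(X_s, ℚ))` is SEMISIMPLE
(completely reducible); the same holds after replacing `S` by any connected finite étale cover
`S' → S` — i.e. for every finite-index subgroup of `π₁(S(ℂ), s)`, equivalently for every finite-index
subgroup of its image `Γ_s` — which is the reduction step printed in the proof of (4.2.9) (a).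

## Rendering (real carriers of `AlgebraicMonodromyMumfordTate.lean`; no hypothesis structure)

The geometric setting of that file: a smooth projective family `f : 𝒳 ⟶ S`
(`Motives.IsSmoothProjectiveFamily f n`) over a smooth quasi-projective `ℂ`-scheme `S`
(`IsQuasiProjectiveOver S`, `Smooth S.hom`), cohomologically locally trivial over `S(ℂ)` (`hU`; PROVED
for such families elsewhere in the tree and, as in the sibling facts, taken as a hypothesis to keep the
import cone small), the monodromy group `Γ_s = ratMonodromyGroup f k hU s ≤ GL(Hᵏ(X_s(ℂ); ℚ))`
(rational transports of loops at `s`; it only sees the path component of `s` in `S(ℂ)`, the complex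
points of a connected component of `S`, so — exactly as for the sibling facts — no connectedness
hypothesis is recorded). The representation of `π₁(S(ℂ), s)` on `Hᵏ(X_s, ℚ)` factors through `Γ_s`, so
«semisimple» is a property of the `Γ_s`-module `Hᵏ(X_s(ℂ); ℚ)`; it is rendered ELEMENTARILY (no group
algebra): every `Γ'`-stable ℚ-subspace has a `Γ'`-stable complement, for every subgroup `Γ' ≤ Γ_s` of
finite index (`(Γ'.subgroupOf Γ_s).FiniteIndex`, the idiom of
`deligne_finiteIndex_monodromy_le_mumfordTateGroup`); `Γ' = Γ_s` is the printed (4.2.6), the general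
`Γ'` is (4.2.6) on the finite étale cover of `S` with fundamental group the preimage of `Γ'`.

* `Deligne1971_monodromy_semisimple` — the NAMED FACT.
* PROVED consumer shapes: `….exists_isCompl` (the case `Γ' = Γ_s`), `….exists_isCompl_of_isRatTransport`
  (invariance tested on rational transports of loops).
* PROVED (appended): complete reducibility descends to subgroups of finite index in characteristic `0`
  (Clifford for the normal core, Maschke averaging: `Deligne1971_monodromy_semisimple.exists_isCompl_of_normal`,
  `….exists_isCompl_of_finiteIndex_le`, `….exists_isCompl_of_finiteIndex`, on the sibling file's
  `IsStableUnder` / `IsIrreducibleUnder`), whence the EQUIVALENCE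
  `Deligne1971_monodromy_semisimple_iff_completelyReducible` with the sibling named fact
  `deligne1971_ratMonodromy_completelyReducible` of `MonodromySemisimpleSubvariations.lean` (Hodge II
  4.2.6 for the full monodromy group `Γ_s`, vendored earlier on the same carriers): the tree owes ONE
  semisimplicity fact, in two equivalent spellings.

What is NOT here: the abstract statement for a category `𝒞` of continuous families satisfying
(4.2.2) (the tree's `VHSData` records no holomorphy); (4.2.7)–(4.2.8) (Hodge structure on
`End` of the local system, determinants of sub-local systems); (4.2.9) (b) (non-proper case, unipotent
radical); the Zariski-closure form «`G⁰` semisimple» of (4.2.9) (a) — consumers wanting it combine the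
present fact with `glZariskiClosure`/`glIdentityComponent` themselves.

## References
* [DeligneHodgeII1971] P. Deligne, Théorie de Hodge II, Publ. Math. IHÉS 40 (1971) 5–57: Thm. 4.2.6
  and footnote (p. 45), Cor. 4.2.8 (pp. 46–47), Cor. 4.2.9 (p. 48); §4.1 (théorème de la partie fixe,
  4.1.1 p. 40, 4.1.2 p. 42 — in the tree as `deligne_globalInvariantCycles` and
  `HodgeTypeOfFlatSections`).
* [CarlsonMullerStachPeters2017] J. Carlson, S. Müller-Stach, C. Peters, Period Mappings and Period
  Domains, 2nd ed., §15.3 (monodromy group `Γ`, Lemma–Def. 15.3.7) — vocabulary of the sibling file.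
* [VoisinHodgeII2003] C. Voisin, Hodge Theory and Complex Algebraic Geometry II, §3.1.2 (local systems
  and monodromy) — vocabulary of the rational transports.
-/

noncomputable section

open CategoryTheory AlgebraicGeometry
open _root_.Topology
open Literature.AlgebraicTopology.SingularHomology Literature.Geometry.Kaehler
open Literature.AlgebraicGeometry.Motives

namespace Literature.AlgebraicGeometry.HodgeTheory

section HodgeTheory

/-! ### The named fact -/

/-- **The monodromy representation of a smooth projective family is semisimple, also after passing to
a finite étale cover** (Deligne, *Théorie de Hodge II*, Thm. 4.2.6 with its footnote, and the reduction
step of Cor. 4.2.9 (a); named fact). Printed: «Soit `S` un espace topologique connexe, localement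
connexe et localement simplement connexe, muni d'un point base `s`. Soit `𝒞` une catégorie de familles
continues de structures de Hodge sur `S` qui vérifie les conditions (4.2.2). Alors, si `H ∈ Ob 𝒞`, la
représentation de `π₁(S, s)` sur la fibre `(H_ℚ)_s` est semi-simple» — applicable (footnote, p. 45;
(4.2.5) (iii)) to `H = Rᵏf_*ℚ` for `f` smooth projective over a smooth connected scheme `S`, and
(proof of 4.2.9 (a): «quitte à remplacer `S` par un revêtement étale fini») to every connected finite
étale cover of `S`, i.e. to every finite-index subgroup of `π₁(S(ℂ), s)`. On the tree's carriers: for a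
smooth projective family `f : 𝒳 ⟶ S` of relative dimension `n` over a smooth quasi-projective `S/ℂ`,
cohomologically locally trivial over `S(ℂ)` (`hU`), a degree `k`, a base point `s`, and a subgroup `Γ'`
of finite index in the monodromy group `Γ_s = ratMonodromyGroup f k hU s`: every `Γ'`-stable
ℚ-subspace `W ⊆ Hᵏ(X_s(ℂ); ℚ)` has a `Γ'`-stable complement `W'` (`IsCompl W W'`) — the `Γ'`-module
`Hᵏ(X_s(ℂ); ℚ)` is completely reducible. [cite: DeligneHodgeII1971, Théorème 4.2.6 (with footnote) and Corollaire 4.2.9 (a)] -/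
def Deligne1971_monodromy_semisimple : Prop :=
  ∀ ⦃𝒳 S : SchemeOver ℂ⦄ (f : 𝒳 ⟶ S) (n k : ℕ)
    (_hf : IsSmoothProjectiveFamily f n), IsQuasiProjectiveOver S → Smooth S.hom →
    ∀ (hU : IsCohomologicallyLocallyTrivialOn f (Set.univ : Set (ComplexPoints S)))
    (s : (Set.univ : Set (ComplexPoints S)))
    (Γ' : Subgroup (singularCohomology ℚ ℚ (ComplexPoints (fiberOver f s.1)) k ≃ₗ[ℚ]
        singularCohomology ℚ ℚ (ComplexPoints (fiberOver f s.1)) k)),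
    Γ' ≤ ratMonodromyGroup f k hU s → (Γ'.subgroupOf (ratMonodromyGroup f k hU s)).FiniteIndex →
    ∀ W : Submodule ℚ (singularCohomology ℚ ℚ (ComplexPoints (fiberOver f s.1)) k),
      (∀ g ∈ Γ', ∀ v ∈ W, g v ∈ W) →
      ∃ W' : Submodule ℚ (singularCohomology ℚ ℚ (ComplexPoints (fiberOver f s.1)) k),
        IsCompl W W' ∧ ∀ g ∈ Γ', ∀ v ∈ W', g v ∈ W'

/-! ### Consumer shapes (proved from the named fact) -/

section Corollaries

variable {𝒳 S : SchemeOver ℂ}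

/-- **Complete reducibility of the full monodromy representation** (Deligne, Hodge II, Thm. 4.2.6,
the case `Γ' = Γ_s`): every `Γ_s`-stable ℚ-subspace of `Hᵏ(X_s(ℂ); ℚ)` has a `Γ_s`-stable complement.
[cite: DeligneHodgeII1971, Théorème 4.2.6] -/
theorem Deligne1971_monodromy_semisimple.exists_isCompl (H : Deligne1971_monodromy_semisimple)
    (f : 𝒳 ⟶ S) (n k : ℕ) (hf : IsSmoothProjectiveFamily f n) (hS : IsQuasiProjectiveOver S)
    (hSs : Smooth S.hom) (hU : IsCohomologicallyLocallyTrivialOn f (Set.univ : Set (ComplexPoints S)))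
    (s : (Set.univ : Set (ComplexPoints S)))
    (W : Submodule ℚ (singularCohomology ℚ ℚ (ComplexPoints (fiberOver f s.1)) k))
    (hW : ∀ g ∈ ratMonodromyGroup f k hU s, ∀ v ∈ W, g v ∈ W) :
    ∃ W' : Submodule ℚ (singularCohomology ℚ ℚ (ComplexPoints (fiberOver f s.1)) k),
      IsCompl W W' ∧ ∀ g ∈ ratMonodromyGroup f k hU s, ∀ v ∈ W', g v ∈ W' := by
  have hfi : ((ratMonodromyGroup f k hU s).subgroupOf (ratMonodromyGroup f k hU s)).FiniteIndex := by
    rw [Subgroup.subgroupOf_self]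
    infer_instance
  exact H f n k hf hS hSs hU s (ratMonodromyGroup f k hU s) le_rfl hfi W hW

/-- The same with invariance tested on the rational transports of loops at `s` (the form in which the
tree produces monodromy transformations, `IsRatTransport`): a ℚ-subspace stable under every rational
transport of every loop at `s` has a complement with the same property.
[cite: DeligneHodgeII1971, Théorème 4.2.6] [cite: VoisinHodgeII2003, §3.1.2] -/
theorem Deligne1971_monodromy_semisimple.exists_isCompl_of_isRatTransport
    (H : Deligne1971_monodromy_semisimple)
    (f : 𝒳 ⟶ S) (n k : ℕ) (hf : IsSmoothProjectiveFamily f n) (hS : IsQuasiProjectiveOver S)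
    (hSs : Smooth S.hom) (hU : IsCohomologicallyLocallyTrivialOn f (Set.univ : Set (ComplexPoints S)))
    (s : (Set.univ : Set (ComplexPoints S)))
    (W : Submodule ℚ (singularCohomology ℚ ℚ (ComplexPoints (fiberOver f s.1)) k))
    (hW : ∀ (γ : Path.Homotopic.Quotient s s)
      (T : singularCohomology ℚ ℚ (ComplexPoints (fiberOver f s.1)) k ≃ₗ[ℚ]
        singularCohomology ℚ ℚ (ComplexPoints (fiberOver f s.1)) k),
      IsRatTransport f k hU γ T → ∀ v ∈ W, T v ∈ W) :
    ∃ W' : Submodule ℚ (singularCohomology ℚ ℚ (ComplexPoints (fiberOver f s.1)) k),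
      IsCompl W W' ∧ ∀ (γ : Path.Homotopic.Quotient s s)
        (T : singularCohomology ℚ ℚ (ComplexPoints (fiberOver f s.1)) k ≃ₗ[ℚ]
          singularCohomology ℚ ℚ (ComplexPoints (fiberOver f s.1)) k),
        IsRatTransport f k hU γ T → ∀ v ∈ W', T v ∈ W' := by
  have hW' : ∀ g ∈ ratMonodromyGroup f k hU s, ∀ v ∈ W, g v ∈ W := by
    intro g hg v hv
    obtain ⟨γ, hγ⟩ := (mem_ratMonodromyGroup_iff f k hU s g).1 hg
    exact hW γ g hγ v hv
  obtain ⟨W', hc, hW'inv⟩ := H.exists_isCompl f n k hf hS hSs hU s W hW'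
  exact ⟨W', hc, fun γ T hT v hv => hW'inv T (mem_ratMonodromyGroup_of_isRatTransport f k hU hT) v hv⟩

end Corollaries

/-! ### Complete reducibility descends to subgroups of finite index (Clifford, Maschke), and the
### equivalence with `deligne1971_ratMonodromy_completelyReducible`

Appended 2026-08-29 (same seat). The tree's `MonodromySemisimpleSubvariations.lean` already vendors
Hodge II Thm. 4.2.6 over `ℚ` for the FULL monodromy group as the named fact
`deligne1971_ratMonodromy_completelyReducible` (its FACT A; identical carriers, `bettiCohomology X k`
being an abbreviation of `singularCohomology ℚ ℚ X(ℂ) k`), i.e. exactly the case `Γ' = Γ_s` of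
`Deligne1971_monodromy_semisimple`. The finite-index form is not stronger: it follows from FACT A by
pure algebra, which we PROVE here, so that the two named facts are equivalent
(`Deligne1971_monodromy_semisimple_iff_completelyReducible`) and the tree owes ONE semisimplicity fact.

The algebra (finite-dimensional `V` over a field `K`, a representation `ρ : G →* End_K V`, "completely
reducible under `A`" meaning every `A`-stable subspace has an `A`-stable complement, phrased with the
sibling file's `IsStableUnder` / `IsIrreducibleUnder`):
* (Clifford) if `V` is completely reducible under `G` and `N ⊴ G` is normal, then `V` is the sum of its
  `N`-stable `N`-irreducible subspaces (`G` permutes them, so their sum `M` is `G`-stable; a `G`-stable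
  complement of `M` would contain an `N`-irreducible), hence completely reducible under `N` (a space
  which is the sum of its irreducible stable subspaces is completely reducible: take a stable `W'`
  maximal among those meeting `W` trivially);
* (Maschke) if `N ≤ H` has finite index, `char K = 0`, and `V` is completely reducible under `N`,
  then it is under `H`: average an `N`-equivariant projection `P` onto an `H`-stable `W` over the
  left cosets `H/N`, `S = ∑_{H/N} ρ(h) P ρ(h)⁻¹`; `S` commutes with `ρ(H)`, maps into `W` and is
  `[H:N] ≠ 0` on `W`, so `ker S` is an `H`-stable complement;
* for `H ≤ G` of finite index apply both to the normal core `N` of `H`.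
References for the algebra: Clifford, Ann. of Math. 38 (1937) Thm. 1; Curtis–Reiner, *Representation
theory of finite groups and associative algebras* (1962), (49.2) and §10 (Maschke averaging). -/

section FiniteIndexDescent

variable {K : Type*} [Field K] {V : Type*} [AddCommGroup V] [Module K V]

namespace IsStableUnder

variable {α : Type*} {g : α → V →ₗ[K] V} {A : Set α}

/-- A non-zero stable subspace of a finite-dimensional space contains a stable irreducible subspace
(a non-zero stable subspace of minimal dimension). [cite: Deligne1987, §1.12 (p. 10)] -/
theorem exists_irreducible_le [FiniteDimensional K V] {M : Submodule K V} (hM : IsStableUnder g A M)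
    (hM0 : M ≠ ⊥) : ∃ U ≤ M, IsStableUnder g A U ∧ IsIrreducibleUnder g A U := by
  obtain ⟨U, ⟨hUM, hU0, hUs⟩, hmin⟩ := IsArtinian.set_has_minimal (R := K) (M := V)
    {U : Submodule K V | U ≤ M ∧ U ≠ ⊥ ∧ IsStableUnder g A U} ⟨M, le_rfl, hM0, hM⟩
  refine ⟨U, hUM, hUs, hU0, fun W' hW'U hW's ↦ ?_⟩
  by_contra h
  push Not at h
  exact hmin W' ⟨hW'U.trans hUM, h.1, hW's⟩ (lt_of_le_of_ne hW'U h.2)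

/-- **A space which is the sum of its stable irreducible subspaces is completely reducible**: every
stable subspace `W` has a stable complement (a stable `W'` maximal among those with `W ⊓ W' = ⊥`; if
`W ⊔ W' ≠ ⊤` some irreducible `U` is not below `W ⊔ W'`, then `U ⊓ (W ⊔ W') = ⊥` and `W' ⊔ U`
contradicts maximality). [cite: Deligne1987, §1.12 (p. 10)] -/
theorem exists_isCompl_of_sSup_irreducible_eq_top [FiniteDimensional K V]
    (htop : sSup {U : Submodule K V | IsStableUnder g A U ∧ IsIrreducibleUnder g A U} = ⊤)
    {W : Submodule K V} (hW : IsStableUnder g A W) :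
    ∃ W' : Submodule K V, IsCompl W W' ∧ IsStableUnder g A W' := by
  obtain ⟨W', ⟨hW's, hdis⟩, hmax⟩ :=
    set_has_maximal_iff_noetherian.2 (inferInstance : IsNoetherian K V)
      {W' : Submodule K V | IsStableUnder g A W' ∧ Disjoint W W'}
      ⟨⊥, IsStableUnder.bot, disjoint_bot_right⟩
  refine ⟨W', ⟨hdis, codisjoint_iff.2 ?_⟩, hW's⟩
  by_contra hne
  obtain ⟨U, ⟨hUs, hUi⟩, hUle⟩ :
      ∃ U ∈ {U : Submodule K V | IsStableUnder g A U ∧ IsIrreducibleUnder g A U}, ¬U ≤ W ⊔ W' := by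
    by_contra h
    push Not at h
    exact hne (top_le_iff.1 (htop ▸ sSup_le h))
  have hinf : U ⊓ (W ⊔ W') = ⊥ := by
    rcases hUi.2 _ inf_le_left (hUs.inf (hW.sup hW's)) with h | h
    · exact h
    · exact absurd (h ▸ inf_le_right : U ≤ W ⊔ W') hUle
  have hdis' : Disjoint W (W' ⊔ U) := by
    rw [Submodule.disjoint_def] at hdis ⊢
    intro w hw hw'
    obtain ⟨y, hy, u, hu, rfl⟩ := Submodule.mem_sup.1 hw'
    have hu' : u ∈ U ⊓ (W ⊔ W') := by
      refine ⟨hu, ?_⟩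
      have : u = (y + u) - y := by abel
      rw [this]
      exact Submodule.sub_mem _ (Submodule.mem_sup_left hw) (Submodule.mem_sup_right hy)
    rw [hinf, Submodule.mem_bot] at hu'
    subst hu'
    rw [add_zero] at hw ⊢
    exact hdis y hw hy
  have hlt : W' < W' ⊔ U :=
    lt_of_le_of_ne le_sup_left fun heq ↦
      hUle (le_sup_right.trans (heq.symm.le.trans le_sup_right))
  exact hmax _ ⟨hW's.sup hUs, hdis'⟩ hlt

end IsStableUnder

namespace Deligne1971_monodromy_semisimple

variable {G : Type*} [Group G] (ρ : G →* Module.End K V)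

/-- `ρ(x) ρ(x⁻¹) = 1` on vectors. [folklore] -/
private theorem rep_apply_inv_apply (x : G) (v : V) : ρ x (ρ x⁻¹ v) = v := by
  rw [← Module.End.mul_apply, ← map_mul, mul_inv_cancel, map_one, Module.End.one_apply]

/-- `ρ(x⁻¹) ρ(x) = 1` on vectors. [folklore] -/
private theorem rep_inv_apply_apply (x : G) (v : V) : ρ x⁻¹ (ρ x v) = v := by
  rw [← Module.End.mul_apply, ← map_mul, inv_mul_cancel, map_one, Module.End.one_apply]

/-- For a NORMAL subgroup `N`, the translate `ρ(x) W` of an `N`-stable subspace is `N`-stable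
(`ρ(n) ρ(x) = ρ(x) ρ(x⁻¹ n x)`). [cite: Deligne1987, §1.12 (p. 10)] -/
theorem isStableUnder_map_of_normal {N : Subgroup G} [hN : N.Normal] {W : Submodule K V}
    (hW : IsStableUnder ρ (N : Set G) W) (x : G) : IsStableUnder ρ (N : Set G) (W.map (ρ x)) := by
  rintro n hn _ ⟨w, hw, rfl⟩
  refine ⟨ρ (x⁻¹ * n * x) w, hW _ (hN.conj_mem' n hn x) w hw, ?_⟩
  rw [← Module.End.mul_apply, ← map_mul, ← Module.End.mul_apply, ← map_mul]
  congr 2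
  group

/-- For a NORMAL subgroup `N`, the translate `ρ(x) W` of an `N`-irreducible subspace is
`N`-irreducible (`G` permutes the irreducible `N`-subspaces — Clifford). [cite: Deligne1987, §1.12 (p. 10)] -/
theorem isIrreducibleUnder_map_of_normal {N : Subgroup G} [N.Normal] {W : Submodule K V}
    (hW : IsIrreducibleUnder ρ (N : Set G) W) (x : G) :
    IsIrreducibleUnder ρ (N : Set G) (W.map (ρ x)) := by
  have hback : ∀ W' : Submodule K V, (W'.map (ρ x⁻¹)).map (ρ x) = W' := fun W' ↦ by
    rw [← Submodule.map_comp, ← Module.End.mul_eq_comp, ← map_mul, mul_inv_cancel, map_one,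
      Module.End.one_eq_id, Submodule.map_id]
  refine ⟨fun h0 ↦ hW.1 ?_, fun W' hle hst ↦ ?_⟩
  · rw [eq_bot_iff] at h0 ⊢
    intro w hw
    have h := h0 (Submodule.mem_map_of_mem (f := ρ x) hw)
    rw [Submodule.mem_bot] at h ⊢
    rw [← rep_inv_apply_apply ρ x w, h, map_zero]
  · have hle' : W'.map (ρ x⁻¹) ≤ W := by
      rintro _ ⟨v, hv, rfl⟩
      obtain ⟨w, hw, hwv⟩ := Submodule.mem_map.1 (hle hv)
      rw [← hwv, rep_inv_apply_apply]
      exact hw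
    rcases hW.2 _ hle' (isStableUnder_map_of_normal ρ hst x⁻¹) with h | h
    · left
      rw [← hback W', h, Submodule.map_bot]
    · right
      rw [← hback W', h]

/-- **Clifford.** If `V` (finite-dimensional) is completely reducible under `G` and `N` is a normal
subgroup, then `V` is the sum of its `N`-stable `N`-irreducible subspaces: their sum `M` is `G`-stable
(`G` permutes them), and a `G`-stable complement `M' ≠ 0` of `M` would contain an `N`-irreducible,
which lies in `M ⊓ M' = 0`. [cite: Deligne1987, §1.12 (p. 10)] -/
theorem sSup_irreducible_eq_top_of_normal [FiniteDimensional K V] (N : Subgroup G) [N.Normal]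
    (hG : ∀ W : Submodule K V, IsStableUnder ρ (Set.univ : Set G) W →
      ∃ W' : Submodule K V, IsCompl W W' ∧ IsStableUnder ρ (Set.univ : Set G) W') :
    sSup {U : Submodule K V | IsStableUnder ρ (N : Set G) U ∧ IsIrreducibleUnder ρ (N : Set G) U}
      = ⊤ := by
  set I := {U : Submodule K V | IsStableUnder ρ (N : Set G) U ∧ IsIrreducibleUnder ρ (N : Set G) U}
    with hI
  have hM : IsStableUnder ρ (Set.univ : Set G) (sSup I) := by
    intro x _ v hv
    have h1 : ρ x v ∈ (sSup I).map (ρ x) := Submodule.mem_map_of_mem hv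
    refine (show (sSup I).map (ρ x) ≤ sSup I from ?_) h1
    rw [Submodule.map_le_iff_le_comap]
    refine sSup_le fun U hU ↦ ?_
    rw [← Submodule.map_le_iff_le_comap]
    exact le_sSup ⟨isStableUnder_map_of_normal ρ hU.1 x, isIrreducibleUnder_map_of_normal ρ hU.2 x⟩
  by_contra hne
  obtain ⟨M', hc, hM's⟩ := hG _ hM
  have hM'0 : M' ≠ ⊥ := by
    rintro rfl
    exact hne (eq_top_of_isCompl_bot hc)
  obtain ⟨U, hUM', hUs, hUi⟩ :=
    IsStableUnder.exists_irreducible_le (hM's.anti (Set.subset_univ (N : Set G))) hM'0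
  have hUM : U ≤ sSup I := le_sSup ⟨hUs, hUi⟩
  exact hUi.1 (eq_bot_iff.2 ((le_inf hUM hUM').trans hc.disjoint.le_bot))

/-- **Clifford, complete-reducibility form**: complete reducibility under `G` descends to every
normal subgroup `N`. [cite: Deligne1987, §1.12 (p. 10)] -/
theorem exists_isCompl_of_normal [FiniteDimensional K V] (N : Subgroup G) [N.Normal]
    (hG : ∀ W : Submodule K V, IsStableUnder ρ (Set.univ : Set G) W →
      ∃ W' : Submodule K V, IsCompl W W' ∧ IsStableUnder ρ (Set.univ : Set G) W')
    {W : Submodule K V} (hW : IsStableUnder ρ (N : Set G) W) :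
    ∃ W' : Submodule K V, IsCompl W W' ∧ IsStableUnder ρ (N : Set G) W' :=
  IsStableUnder.exists_isCompl_of_sSup_irreducible_eq_top
    (sSup_irreducible_eq_top_of_normal ρ N hG) hW

/-- **Maschke averaging.** `N ≤ H` of finite index, characteristic `0`: if `V` is completely
reducible under `N` then it is under `H`. For an `H`-stable `W` with `N`-equivariant projection `P`
onto `W`, `S = ∑_{hN ∈ H/N} ρ(h) P ρ(h⁻¹)` (well defined) commutes with `ρ(H)` (which permutes the
left cosets), takes values in `W` and is multiplication by `[H:N] ≠ 0` on `W`, so `ker S` is an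
`H`-stable complement. [cite: Deligne1987, §1.12 (p. 10)] -/
theorem exists_isCompl_of_finiteIndex_le [CharZero K] {N H : Subgroup G} (hNH : N ≤ H)
    [hfi : (N.subgroupOf H).FiniteIndex]
    (hN : ∀ W : Submodule K V, IsStableUnder ρ (N : Set G) W →
      ∃ W' : Submodule K V, IsCompl W W' ∧ IsStableUnder ρ (N : Set G) W')
    {W : Submodule K V} (hW : IsStableUnder ρ (H : Set G) W) :
    ∃ W' : Submodule K V, IsCompl W W' ∧ IsStableUnder ρ (H : Set G) W' := by
  classical
  obtain ⟨W₀, hc₀, hW₀⟩ := hN W (hW.anti (SetLike.coe_subset_coe.2 hNH))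
  -- the `N`-equivariant projection onto `W` along `W₀`
  set P : Module.End K V := W.projection W₀ hc₀ with hP
  have hPW : ∀ v, P v ∈ W := fun v ↦ Submodule.projection_apply_mem hc₀ v
  have hPid : ∀ w ∈ W, P w = w := fun w hw ↦ Submodule.projection_apply_of_mem_left hc₀ hw
  have hP0 : ∀ w₀ ∈ W₀, P w₀ = 0 := fun w₀ hw₀ ↦ Submodule.projection_apply_of_mem_right hc₀ hw₀
  have hPN : ∀ n ∈ N, ρ n * P = P * ρ n := by
    intro n hn
    ext v
    obtain ⟨w, hw, w₀, hw₀, rfl⟩ := Submodule.mem_sup.1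
      (show v ∈ W ⊔ W₀ by rw [hc₀.sup_eq_top]; exact Submodule.mem_top)
    simp only [Module.End.mul_apply, map_add, hPid w hw, hP0 w₀ hw₀,
      hPid _ (hW n (hNH hn) w hw), hP0 _ (hW₀ n hn w₀ hw₀), map_zero, add_zero]
  -- conjugates of `P` by elements of `H`
  set C : H → Module.End K V := fun h ↦ ρ (h : G) * P * ρ ((h : G)⁻¹) with hCdef
  have hC_mul_N : ∀ (h n : H), n ∈ N.subgroupOf H → C (h * n) = C h := by
    intro h n hn
    rw [Subgroup.mem_subgroupOf] at hn
    simp only [hCdef, Subgroup.coe_mul, mul_inv_rev, map_mul, ← mul_assoc]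
    rw [mul_assoc (ρ (h : G)) (ρ (n : G)) P, hPN _ hn, ← mul_assoc, mul_assoc _ (ρ (n : G)),
      ← map_mul, mul_inv_cancel, map_one, mul_one]
  have hC_conj : ∀ h x : H, ρ (h : G) * C x * ρ ((h : G)⁻¹) = C (h * x) := by
    intro h x
    simp only [hCdef, Subgroup.coe_mul, mul_inv_rev, map_mul, ← mul_assoc]
  have hCW : ∀ (x : H) (v : V), C x v ∈ W := fun x v ↦ by
    simp only [hCdef, Module.End.mul_apply]
    exact hW _ x.2 _ (hPW _)
  have hCid : ∀ (x : H), ∀ w ∈ W, C x w = w := fun x w hw ↦ by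
    simp only [hCdef, Module.End.mul_apply]
    rw [hPid _ (hW _ (H.inv_mem x.2) w hw), rep_apply_inv_apply]
  -- the average over `H / N`
  haveI : Fintype (H ⧸ N.subgroupOf H) := Fintype.ofFinite _
  set S : Module.End K V := ∑ q : H ⧸ N.subgroupOf H, C q.out with hSdef
  have hS_conj : ∀ h : H, ρ (h : G) * S * ρ ((h : G)⁻¹) = S := by
    intro h
    rw [hSdef, Finset.mul_sum, Finset.sum_mul]
    refine Fintype.sum_equiv (MulAction.toPerm h) _ _ fun q ↦ ?_
    rw [MulAction.toPerm_apply, hC_conj]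
    obtain ⟨n, hn⟩ := QuotientGroup.mk_out_eq_mul (N.subgroupOf H) (h * q.out)
    have hq : (QuotientGroup.mk (h * q.out) : H ⧸ N.subgroupOf H) = h • q := by
      rw [← smul_eq_mul, MulAction.Quotient.mk_smul_out]
    rw [hq] at hn
    rw [hn, hC_mul_N _ _ n.2]
  have hS_comm : ∀ h ∈ H, ρ h * S = S * ρ h := by
    intro h hh
    have := hS_conj ⟨h, hh⟩
    simp only at this
    calc ρ h * S = ρ h * S * ρ h⁻¹ * ρ h := by
            rw [mul_assoc, ← map_mul, inv_mul_cancel, map_one, mul_one]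
      _ = S * ρ h := by rw [this]
  have hSW : ∀ v, S v ∈ W := fun v ↦ by
    rw [hSdef, LinearMap.sum_apply]
    exact Submodule.sum_mem _ fun q _ ↦ hCW _ _
  have hSid : ∀ w ∈ W, S w = (Fintype.card (H ⧸ N.subgroupOf H) : K) • w := fun w hw ↦ by
    rw [hSdef, LinearMap.sum_apply, Finset.sum_congr rfl fun q _ ↦ hCid q.out w hw, Finset.sum_const,
      Finset.card_univ, Nat.cast_smul_eq_nsmul]
  have hm : (Fintype.card (H ⧸ N.subgroupOf H) : K) ≠ 0 := Nat.cast_ne_zero.2 Fintype.card_ne_zero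
  refine ⟨LinearMap.ker S, ⟨?_, ?_⟩, ?_⟩
  · rw [Submodule.disjoint_def]
    intro w hw hw'
    rw [LinearMap.mem_ker, hSid w hw] at hw'
    exact (smul_eq_zero.1 hw').resolve_left hm
  · rw [codisjoint_iff, eq_top_iff]
    intro v _
    refine Submodule.mem_sup.2 ⟨(Fintype.card (H ⧸ N.subgroupOf H) : K)⁻¹ • S v,
      W.smul_mem _ (hSW v), v - (Fintype.card (H ⧸ N.subgroupOf H) : K)⁻¹ • S v, ?_, by abel⟩
    rw [LinearMap.mem_ker, map_sub, map_smul, hSid _ (hSW v), smul_smul, inv_mul_cancel₀ hm, one_smul,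
      sub_self]
  · intro h hh v hv
    rw [LinearMap.mem_ker] at hv ⊢
    rw [← Module.End.mul_apply, ← hS_comm h hh, Module.End.mul_apply, hv, map_zero]

/-- **Complete reducibility descends to subgroups of finite index** (characteristic `0`,
finite-dimensional `V`): Clifford for the normal core `N` of `H`, then Maschke averaging over `H/N`.
[cite: Deligne1987, §1.12 (p. 10)] -/
theorem exists_isCompl_of_finiteIndex [FiniteDimensional K V] [CharZero K] (H : Subgroup G)
    [H.FiniteIndex]
    (hG : ∀ W : Submodule K V, IsStableUnder ρ (Set.univ : Set G) W →
      ∃ W' : Submodule K V, IsCompl W W' ∧ IsStableUnder ρ (Set.univ : Set G) W')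
    {W : Submodule K V} (hW : IsStableUnder ρ (H : Set G) W) :
    ∃ W' : Submodule K V, IsCompl W W' ∧ IsStableUnder ρ (H : Set G) W' := by
  haveI : (H.normalCore.subgroupOf H).FiniteIndex := by
    refine ⟨fun h0 ↦ Subgroup.FiniteIndex.index_ne_zero (H := H.normalCore) ?_⟩
    rw [← Subgroup.relIndex_mul_index (Subgroup.normalCore_le H)]
    exact mul_eq_zero_of_left h0 _
  exact exists_isCompl_of_finiteIndex_le ρ (Subgroup.normalCore_le H)
    (fun W hW ↦ exists_isCompl_of_normal ρ H.normalCore hG hW) hW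

end Deligne1971_monodromy_semisimple

end FiniteIndexDescent

/-! ### The equivalence of the two named facts -/

section Equivalence

/-- FACT A of `MonodromySemisimpleSubvariations` (Hodge II 4.2.6 for the full monodromy group) is the
case `Γ' = Γ_s` of `Deligne1971_monodromy_semisimple`. [cite: DeligneHodgeII1971, Théorème 4.2.6] -/
theorem deligne1971_ratMonodromy_completelyReducible_of_semisimple
    (H : Deligne1971_monodromy_semisimple) : deligne1971_ratMonodromy_completelyReducible :=
  fun _ _ f n k hf hq hS hU s W hW ↦ H.exists_isCompl f n k hf hq hS hU s W hW

/-- **`Deligne1971_monodromy_semisimple` follows from FACT A** (complete reducibility of the full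
monodromy group) by Clifford + Maschke (`exists_isCompl_of_finiteIndex`), `Hᵏ(X_s(ℂ); ℚ)` being
finite-dimensional for the smooth projective fibre `X_s`.
[cite: DeligneHodgeII1971, Théorème 4.2.6 and Corollaire 4.2.9 (a)] -/
theorem Deligne1971_monodromy_semisimple_of_completelyReducible
    (h : deligne1971_ratMonodromy_completelyReducible) : Deligne1971_monodromy_semisimple := by
  intro 𝒳 S f n k hf hq hS hU s Γ' hle hfi W hW
  haveI : FiniteDimensional ℚ (singularCohomology ℚ ℚ (ComplexPoints (fiberOver f s.1)) k) :=
    finite_singularCohomology_rat_complexPoints (hf.isSmoothProjective s.1) k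
  set Γ := ratMonodromyGroup f k hU s with hΓ
  set ρ : Γ →* Module.End ℚ (singularCohomology ℚ ℚ (ComplexPoints (fiberOver f s.1)) k) :=
    LinearEquiv.automorphismGroup.toLinearMapMonoidHom.comp Γ.subtype with hρdef
  have hρ : ∀ (x : Γ) (v : singularCohomology ℚ ℚ (ComplexPoints (fiberOver f s.1)) k),
      ρ x v = (x : _ ≃ₗ[ℚ] _) v := fun _ _ ↦ rfl
  haveI : (Γ'.subgroupOf Γ).FiniteIndex := hfi
  have hG : ∀ W₁ : Submodule ℚ (singularCohomology ℚ ℚ (ComplexPoints (fiberOver f s.1)) k),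
      IsStableUnder ρ (Set.univ : Set Γ) W₁ →
        ∃ W₂ : Submodule ℚ _, IsCompl W₁ W₂ ∧ IsStableUnder ρ (Set.univ : Set Γ) W₂ := by
    intro W₁ hW₁
    obtain ⟨W₂, hc, hW₂⟩ := h f n k hf hq hS hU s W₁ fun g hg w hw ↦ by
      rw [← hρ ⟨g, hg⟩]; exact hW₁ ⟨g, hg⟩ (Set.mem_univ _) w hw
    exact ⟨W₂, hc, fun x _ w hw ↦ by rw [hρ]; exact hW₂ x x.2 w hw⟩
  obtain ⟨W', hc, hW's⟩ := Deligne1971_monodromy_semisimple.exists_isCompl_of_finiteIndex ρ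
    (Γ'.subgroupOf Γ) hG (W := W) fun x hx w hw ↦ by
      rw [hρ]; exact hW x (Subgroup.mem_subgroupOf.1 hx) w hw
  exact ⟨W', hc, fun g hg v hv ↦ by
    rw [← hρ ⟨g, hle hg⟩]; exact hW's ⟨g, hle hg⟩ (Subgroup.mem_subgroupOf.2 hg) v hv⟩

/-- **The two named facts are equivalent.** [cite: DeligneHodgeII1971, Théorème 4.2.6 and Corollaire 4.2.9 (a)] -/
theorem Deligne1971_monodromy_semisimple_iff_completelyReducible :
    Deligne1971_monodromy_semisimple ↔ deligne1971_ratMonodromy_completelyReducible :=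
  ⟨deligne1971_ratMonodromy_completelyReducible_of_semisimple,
    Deligne1971_monodromy_semisimple_of_completelyReducible⟩

end Equivalence


end HodgeTheory

end Literature.AlgebraicGeometry.HodgeTheory
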